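import Literature.Analysis.FluidPDE.PeriodicCylinderNeumannGradient
import HarnessLib

/-!
# Frame words of the Neumann problem on the period cell: all derivatives along `{x_h·∇, ∂_θ, ∂_z}`
up to order four by the data

Topic `Literature/Analysis/FluidPDE`. Support file (all results proved, no named facts, no
definitions) for the discharge of the pressure estimate
`Literature.Analysis.FluidPDE.Ferrari1993_periodicCylinderPressureEstimate` (A. B. Ferrari, Comm. Math.
Phys. **155** (1993), Lemma 2 pp. 280–281: the standard `H^s` estimate of `∇p` from the Neumann problem
(10)–(12), "deriving local estimates … and combining them"). Near the wall the `H⁴` estimate of `q`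
is obtained in the commuting frame of the cylinder, `P = x_h·∇ = r∂_r` (`horizontalProj`),
`J = ∂_θ` (`rotGen`), `E = ∂_z` (`cylBasis 2`): the tangential estimate of
`PeriodicCylinderNeumannTangential.lean` controls `‖∇ Z^β q‖_{L²(cell)}` for tangential words `β` in
`{J, E}` of length `≤ 3`, the base estimate of `PeriodicCylinderNeumannGradient.lean` controls `‖∇q‖`,
and the **normal derivatives are recovered from the equation** through the polar identity
`r²(∂₀² + ∂₁²) = P² + J²` (`sq_radius_smul_horizontalLap`):

  `P P f = r² (Δ_K f − E E f) − J J f`   (`cylDeriv_P_P_eq`).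

Since `P, J, E` commute and `J r² = E r² = 0`, `P r² = 2r²`, every frame word of `q` of length `≤ 4`
is a combination, with coefficients bounded on the closed cylinder, of (i) `∇` of tangential words of
length `≤ 3` (controlled), (ii) tangential words of `Δq` of length `≤ 2`, `∇` of such words of length
`≤ 1`, and `∇∂ᵢΔq`. The main result `exists_cellL2_frameWord_le_data` bounds, for all `q`, `G` smooth on
the closed cylinder and `L`-periodic with the Neumann relation `∂_{x_h} q = G` on the wall, every
`‖P^a J^j E^e q‖_{L²(cell)}` with `1 ≤ a + j + e ≤ 4` by `C` times the **data size**

  `𝒟 = Σ_{|γ|≤2} (‖Z^γ Δq‖ + ‖∇Z^γ G‖ + ‖Z^γ G‖) + Σ_{|γ|≤1} ‖∇Z^γ Δq‖ + Σᵢ ‖∇∂ᵢ Δq‖`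

(`γ` tangential words; sizes `cellL2`), which the word-norm layer (`PeriodicCylinderWordNorms.lean`)
bounds by the tree's Sobolev norms of `Δq` (`H²`) and `G` (`H³`). All statements are folklore calculus
given the two cited Neumann estimates of the tree.

Mathlib/tree search: `lean search 'frameWord|cylDeriv_P_P|normal derivative'` — the frame calculus of
`PeriodicCylinderWithinCalculus.lean` (commutators, polar identity) and the two Neumann estimates; no
normal-derivative recovery yet.
-/

noncomputable section

open MeasureTheory Set Function Filter Topology TopologicalSpace WithLp Metric
open scoped ContDiff NNReal ENNReal InnerProductSpace RealInnerProductSpace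

namespace Literature.Analysis.FluidPDE

open Literature.Analysis.FunctionSpaces

/-- Local notation for physical space `ℝ³ = EuclideanSpace ℝ (Fin 3)`. -/
local notation "ℝ³" => EuclideanSpace ℝ (Fin 3)

/-- Local notation for the closed unit cylinder `{r ≤ 1}`. -/
local notation "𝕂" => closure (SetLike.coe unitCylinder : Set (EuclideanSpace ℝ (Fin 3)))

/-- Local notation for the radial field `P = x_h`. -/
local notation "Pf" => (fun y : EuclideanSpace ℝ (Fin 3) => horizontalProj y)

/-- Local notation for the axial field `E = e₂`. -/
local notation "Ef" => (fun _ : EuclideanSpace ℝ (Fin 3) => cylBasis 2)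

variable {F : Type*} [NormedAddCommGroup F] [NormedSpace ℝ F]

/-! ### Commuting a field through a word -/

/-- A smooth field which commutes with every letter of a word (on smooth functions, on the closed
cylinder) passes through the word. [folklore] -/
theorem cylDeriv_cylWord_of_comm {X : ℝ³ → ℝ³} (hX : ContDiff ℝ ∞ X) :
    ∀ (Ws : List (ℝ³ → ℝ³)), (∀ W ∈ Ws, ContDiff ℝ ∞ W) →
      (∀ W ∈ Ws, ∀ {f : ℝ³ → F}, ContDiffOn ℝ ∞ f 𝕂 → ∀ {x : ℝ³}, x ∈ 𝕂 →
        cylDeriv X (cylDeriv W f) x = cylDeriv W (cylDeriv X f) x) →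
      ∀ {f : ℝ³ → F}, ContDiffOn ℝ ∞ f 𝕂 → EqOn (cylDeriv X (cylWord Ws f)) (cylWord Ws (cylDeriv X f)) 𝕂
  | [], _, _, _, _ => fun _ _ => rfl
  | W :: Ws, hs, hc, f, hf => by
    intro x hx
    have hsW : ContDiff ℝ ∞ W := hs W (List.mem_cons_self ..)
    have hsWs : ∀ V ∈ Ws, ContDiff ℝ ∞ V := fun V hV => hs V (List.mem_cons_of_mem _ hV)
    have hcWs : ∀ V ∈ Ws, ∀ {f : ℝ³ → F}, ContDiffOn ℝ ∞ f 𝕂 → ∀ {x : ℝ³}, x ∈ 𝕂 →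
        cylDeriv X (cylDeriv V f) x = cylDeriv V (cylDeriv X f) x := fun V hV => hc V (List.mem_cons_of_mem _ hV)
    have hWs : ContDiffOn ℝ ∞ (cylWord Ws f) 𝕂 := contDiffOn_cylWord hsWs hf
    rw [cylWord_cons, cylWord_cons, hc W (List.mem_cons_self ..) hWs hx]
    exact cylDeriv_congr (cylDeriv_cylWord_of_comm hX Ws hsWs hcWs hf) hx

/-- `J` and `E` commute with `P`, `J`, `E` (the frame is commutative). [folklore] -/
theorem cylDeriv_tanField_frame_comm (b : Bool) : ∀ (W : ℝ³ → ℝ³),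
    (W = Pf ∨ W = rotGen ∨ W = Ef) → ∀ {f : ℝ³ → F}, ContDiffOn ℝ ∞ f 𝕂 → ∀ {x : ℝ³}, x ∈ 𝕂 →
      cylDeriv (tanField b) (cylDeriv W f) x = cylDeriv W (cylDeriv (tanField b) f) x := by
  intro W hW f hf x hx
  rcases hW with rfl | rfl | rfl
  · cases b
    · exact (cylDeriv_horizontalProj_cylBasis_two_comm hf hx).symm
    · exact cylDeriv_rotGen_horizontalProj_comm hf hx
  · cases b
    · exact cylDeriv_two_rotGen_comm hf hx
    · rfl
  · cases b
    · rfl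
    · exact cylDeriv_rotGen_cylBasis_two_comm hf hx

/-- The frame word `P^a J^j E^e` (outermost first). [folklore] -/
theorem mem_frame_of_mem_pje {a j e : ℕ} {W : ℝ³ → ℝ³}
    (hW : W ∈ List.replicate a Pf ++ List.replicate j rotGen ++ List.replicate e Ef) :
    W = Pf ∨ W = rotGen ∨ W = Ef := by
  simp only [List.mem_append, List.mem_replicate] at hW
  rcases hW with (⟨-, rfl⟩ | ⟨-, rfl⟩) | ⟨-, rfl⟩
  · exact Or.inl rfl
  · exact Or.inr (Or.inl rfl)
  · exact Or.inr (Or.inr rfl)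

/-- The frame fields are smooth. [folklore] -/
theorem contDiff_of_frame {W : ℝ³ → ℝ³} (hW : W = Pf ∨ W = rotGen ∨ W = Ef) : ContDiff ℝ ∞ W := by
  rcases hW with rfl | rfl | rfl
  · exact contDiff_horizontalProj
  · exact contDiff_rotGen
  · exact contDiff_const

/-- Smoothness of `P^a J^j E^e f`. [folklore] -/
theorem contDiffOn_cylWord_pje (a j e : ℕ) {f : ℝ³ → F} (hf : ContDiffOn ℝ ∞ f 𝕂) :
    ContDiffOn ℝ ∞ (cylWord (List.replicate a Pf ++ List.replicate j rotGen ++ List.replicate e Ef) f) 𝕂 :=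
  contDiffOn_cylWord (fun _ hW => contDiff_of_frame (mem_frame_of_mem_pje hW)) hf

/-- A tangential letter passes through `P^a J^j E^e`. [folklore] -/
theorem cylDeriv_tanField_cylWord_pje (b : Bool) (a j e : ℕ) {f : ℝ³ → F} (hf : ContDiffOn ℝ ∞ f 𝕂) :
    EqOn (cylDeriv (tanField b) (cylWord (List.replicate a Pf ++ List.replicate j rotGen ++ List.replicate e Ef) f))
      (cylWord (List.replicate a Pf ++ List.replicate j rotGen ++ List.replicate e Ef) (cylDeriv (tanField b) f)) 𝕂 :=
  cylDeriv_cylWord_of_comm (contDiff_tanField b) _ (fun _ hW => contDiff_of_frame (mem_frame_of_mem_pje hW))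
    (fun W hW _ hg _ hx => cylDeriv_tanField_frame_comm b W (mem_frame_of_mem_pje hW) hg hx) hf

/-! ### The polar identity in the form `P² = r²(Δ − E²) − J²`, and `r²` through the frame -/

/-- **The normal derivatives from the equation**: on the closed cylinder,
`P P f = r² (Δ_K f − E E f) − J J f` (`r²(∂₀² + ∂₁²) = P² + J²` and `Δ_K = ∂₀² + ∂₁² + ∂₂²`). [folklore] -/
theorem cylDeriv_P_P_eq {f : ℝ³ → F} (hf : ContDiffOn ℝ ∞ f 𝕂) {x : ℝ³} (hx : x ∈ 𝕂) :
    cylDeriv Pf (cylDeriv Pf f) x =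
      (x 0 ^ 2 + x 1 ^ 2) • (cylLap f x - cylDeriv Ef (cylDeriv Ef f) x) - cylDeriv rotGen (cylDeriv rotGen f) x := by
  have h := sq_radius_smul_horizontalLap hf hx
  rw [cylLap_apply, Fin.sum_univ_three, add_sub_cancel_right, h]
  abel

/-- `r²` is killed by `J` and `E` and doubled by `P`. [folklore] -/
theorem cylDeriv_sqRadius (x : ℝ³) (hx : x ∈ 𝕂) :
    cylDeriv rotGen (fun y : ℝ³ => y 0 ^ 2 + y 1 ^ 2) x = 0 ∧
      cylDeriv Ef (fun y : ℝ³ => y 0 ^ 2 + y 1 ^ 2) x = 0 ∧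
      cylDeriv Pf (fun y : ℝ³ => y 0 ^ 2 + y 1 ^ 2) x = 2 * (x 0 ^ 2 + x 1 ^ 2) := by
  have hc : ∀ i : Fin 3, ContDiffOn ℝ ∞ (fun y : ℝ³ => y i) 𝕂 := fun i => (contDiff_cylCoordFun i).contDiffOn
  have hsq : ∀ (i : Fin 3) (V : ℝ³ → ℝ³), cylDeriv V (fun y : ℝ³ => y i ^ 2) x = 2 * x i * V x i := by
    intro i V
    have h := cylDeriv_mul (V := V) (hc i) (hc i) hx
    simp only [cylDeriv_coord V i hx] at h
    rw [show (fun y : ℝ³ => y i ^ 2) = fun y => y i * y i from funext fun y => sq (y i), h]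
    ring
  have hadd : ∀ V : ℝ³ → ℝ³, cylDeriv V (fun y : ℝ³ => y 0 ^ 2 + y 1 ^ 2) x =
      2 * x 0 * V x 0 + 2 * x 1 * V x 1 := fun V => by
    rw [cylDeriv_add ((hc 0).pow 2) ((hc 1).pow 2) hx, hsq 0 V, hsq 1 V]
  refine ⟨?_, ?_, ?_⟩
  · rw [hadd]; simp [rotGen]; ring
  · rw [hadd]; simp [cylBasis_apply]
  · rw [hadd]; simp [horizontalProj_apply_eq]; ring

/-- A tangential letter passes `r²`: `Z (r² h) = r² Z h`. [folklore] -/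
theorem cylDeriv_tanField_sqRadius_smul (b : Bool) {h : ℝ³ → F} (hh : ContDiffOn ℝ ∞ h 𝕂) {x : ℝ³} (hx : x ∈ 𝕂) :
    cylDeriv (tanField b) (fun y : ℝ³ => (y 0 ^ 2 + y 1 ^ 2) • h y) x = (x 0 ^ 2 + x 1 ^ 2) • cylDeriv (tanField b) h x := by
  have hρ : ContDiffOn ℝ ∞ (fun y : ℝ³ => y 0 ^ 2 + y 1 ^ 2) 𝕂 :=
    (((contDiff_cylCoordFun 0).pow 2).add ((contDiff_cylCoordFun 1).pow 2)).contDiffOn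
  obtain ⟨hJ, hE, -⟩ := cylDeriv_sqRadius x hx
  rw [cylDeriv_smul hρ hh hx]
  cases b
  · simp only [tanField] at hE ⊢
    rw [hE, zero_smul, zero_add]
  · simp only [tanField] at hJ ⊢
    rw [hJ, zero_smul, zero_add]

/-- `P (r² h) = 2 r² h + r² P h`. [folklore] -/
theorem cylDeriv_P_sqRadius_smul {h : ℝ³ → F} (hh : ContDiffOn ℝ ∞ h 𝕂) {x : ℝ³} (hx : x ∈ 𝕂) :
    cylDeriv Pf (fun y : ℝ³ => (y 0 ^ 2 + y 1 ^ 2) • h y) x =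
      (2 * (x 0 ^ 2 + x 1 ^ 2)) • h x + (x 0 ^ 2 + x 1 ^ 2) • cylDeriv Pf h x := by
  have hρ : ContDiffOn ℝ ∞ (fun y : ℝ³ => y 0 ^ 2 + y 1 ^ 2) 𝕂 :=
    (((contDiff_cylCoordFun 0).pow 2).add ((contDiff_cylCoordFun 1).pow 2)).contDiffOn
  obtain ⟨-, -, hP⟩ := cylDeriv_sqRadius x hx
  rw [cylDeriv_smul hρ hh hx, hP]

/-- A tangential word passes `r²`. [folklore] -/
theorem cylWord_tanWord_sqRadius_smul (β : List Bool) {h : ℝ³ → F} (hh : ContDiffOn ℝ ∞ h 𝕂) :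
    EqOn (cylWord (tanWord β) (fun y : ℝ³ => (y 0 ^ 2 + y 1 ^ 2) • h y))
      (fun x => (x 0 ^ 2 + x 1 ^ 2) • cylWord (tanWord β) h x) 𝕂 := by
  induction β with
  | nil => exact fun _ _ => rfl
  | cons b β ih =>
    intro x hx
    rw [tanWord_cons, cylWord_cons, cylWord_cons, cylDeriv_congr ih hx]
    exact cylDeriv_tanField_sqRadius_smul b (contDiffOn_cylWord_tanWord β hh) hx

/-! ### From pointwise bounds to `cellL2` -/

section CellL2Aux

variable {F' : Type*} [NormedAddCommGroup F']

/-- `cellL2 ‖f‖ = cellL2 f` (local copy of the `PeriodicCylinderWordNorms` lemma, to keep this file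
independent of it). [folklore] -/
private theorem cellL2_norm_aux (L : ℝ) (f : ℝ³ → F') : cellL2 L (fun x => ‖f x‖) = cellL2 L f := by
  rw [cellL2, cellL2, eLpNorm_norm]

/-- Triangle inequality for finite sums (local copy). [folklore] -/
private theorem cellL2_sum_le_aux {ι' : Type*} (L : ℝ) (s : Finset ι') {f : ι' → ℝ³ → F'}
    (hf : ∀ i ∈ s, ContinuousOn (f i) 𝕂) :
    cellL2 L (fun x => ∑ i ∈ s, f i x) ≤ ∑ i ∈ s, cellL2 L (f i) := by
  classical
  induction s using Finset.induction_on with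
  | empty => simp [cellL2]
  | insert a s ha ih =>
    have hfa : ContinuousOn (f a) 𝕂 := hf a (Finset.mem_insert_self a s)
    have hfs : ∀ i ∈ s, ContinuousOn (f i) 𝕂 := fun i hi => hf i (Finset.mem_insert_of_mem hi)
    simp only [Finset.sum_insert ha]
    exact (cellL2_add_le L hfa (continuousOn_finsetSum s hfs)).trans (add_le_add le_rfl (ih hfs))

end CellL2Aux

/-- `r(w) ≤ ‖w‖` (local copy; the sibling `PeriodicCylinderFrameInversion` has the public one). [folklore] -/
private theorem cylRadius_le_norm_aux (w : ℝ³) : cylRadius w ≤ ‖w‖ := by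
  rw [cylRadius, EuclideanSpace.norm_eq, Fin.sum_univ_three]
  refine Real.sqrt_le_sqrt ?_
  simp only [Real.norm_eq_abs, sq_abs]
  nlinarith [sq_nonneg (w 2)]

section Sizes

variable {F' : Type*} [NormedAddCommGroup F'] [NormedSpace ℝ F']

/-- `cellL2 (r² h) ≤ cellL2 h` (`r ≤ 1`). [folklore] -/
theorem cellL2_sqRadius_smul_le (L : ℝ) {h : ℝ³ → F'} (hh : ContinuousOn h 𝕂) :
    cellL2 L (fun x : ℝ³ => (x 0 ^ 2 + x 1 ^ 2) • h x) ≤ cellL2 L h := by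
  refine cellL2_mono L hh fun x hx => ?_
  have hxK : x ∈ 𝕂 := subset_closure (cylinderCell_le_unitCylinder L hx)
  have hr1 : cylRadius x ≤ 1 := by rw [closure_unitCylinder] at hxK; exact hxK
  have hr2 : x 0 ^ 2 + x 1 ^ 2 ≤ 1 := by
    rw [← cylRadius_sq]; exact pow_le_one₀ (cylRadius_nonneg x) hr1
  rw [norm_smul, Real.norm_of_nonneg (by positivity)]
  exact mul_le_of_le_one_left (norm_nonneg _) hr2

/-- `cellL2 (∂_Z f) ≤ cellL2 (∇f)` for the tangential fields (real `f`). [folklore] -/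
theorem cellL2_cylDeriv_tanField_le (L : ℝ) (b : Bool) {f : ℝ³ → ℝ} (hf : ContDiffOn ℝ ∞ f 𝕂) :
    cellL2 L (cylDeriv (tanField b) f) ≤ cellL2 L (cylGrad f) :=
  cellL2_mono L (contDiffOn_cylGrad hf).continuousOn fun x hx => by
    rw [Real.norm_eq_abs]
    exact abs_cylDeriv_tanField_le b f (subset_closure (cylinderCell_le_unitCylinder L hx))

/-- `cellL2 (∂_P f) ≤ cellL2 (∇f)` (real `f`). [folklore] -/
theorem cellL2_cylDeriv_P_le (L : ℝ) {f : ℝ³ → ℝ} (hf : ContDiffOn ℝ ∞ f 𝕂) :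
    cellL2 L (cylDeriv Pf f) ≤ cellL2 L (cylGrad f) :=
  cellL2_mono L (contDiffOn_cylGrad hf).continuousOn fun x hx => by
    rw [Real.norm_eq_abs]
    exact abs_cylDeriv_horizontalProj_le f (subset_closure (cylinderCell_le_unitCylinder L hx))

/-- `cellL2 (∇f) ≤ Σᵢ cellL2 (∂ᵢ f)` (real `f`). [folklore] -/
theorem cellL2_cylGrad_le_sum (L : ℝ) {f : ℝ³ → ℝ} (hf : ContDiffOn ℝ ∞ f 𝕂) :
    cellL2 L (cylGrad f) ≤ ∑ i : Fin 3, cellL2 L (cylDeriv (fun _ => cylBasis i) f) := by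
  have hc : ∀ i : Fin 3, ContinuousOn (cylDeriv (fun _ => cylBasis i) f) 𝕂 := fun i =>
    (contDiffOn_cylDeriv contDiff_const hf).continuousOn
  calc cellL2 L (cylGrad f) ≤ cellL2 L (fun x => ∑ i : Fin 3, ‖cylDeriv (fun _ => cylBasis i) f x‖) := by
        refine cellL2_mono L (continuousOn_finsetSum _ fun i _ => (hc i).norm) fun x _ => ?_
        rw [norm_cylGrad, Real.norm_of_nonneg (Finset.sum_nonneg fun i _ => norm_nonneg _)]
        exact norm_fderivWithin_le_sum_cylDeriv f x
    _ ≤ ∑ i : Fin 3, cellL2 L (fun x => ‖cylDeriv (fun _ => cylBasis i) f x‖) :=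
        cellL2_sum_le_aux L _ fun i _ => (hc i).norm
    _ = ∑ i : Fin 3, cellL2 L (cylDeriv (fun _ => cylBasis i) f) :=
        Finset.sum_congr rfl fun i _ => cellL2_norm_aux L _

/-- `cellL2 (∂ᵢ P h) ≤ cellL2 (∇ ∂ᵢ h) + cellL2 (∇ h)` (`[∂ᵢ, P] = ∂_{(eᵢ)_h}`, `‖(eᵢ)_h‖ ≤ 1`). [folklore] -/
theorem cellL2_cylDeriv_basis_P_le (L : ℝ) (i : Fin 3) {h : ℝ³ → ℝ} (hh : ContDiffOn ℝ ∞ h 𝕂) :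
    cellL2 L (cylDeriv (fun _ => cylBasis i) (cylDeriv Pf h)) ≤
      cellL2 L (cylGrad (cylDeriv (fun _ => cylBasis i) h)) + cellL2 L (cylGrad h) := by
  have hi : ContDiffOn ℝ ∞ (cylDeriv (fun _ => cylBasis i) h) 𝕂 := contDiffOn_cylDeriv contDiff_const hh
  have hPi : ContDiffOn ℝ ∞ (cylDeriv Pf (cylDeriv (fun _ => cylBasis i) h)) 𝕂 := contDiffOn_cylDeriv contDiff_horizontalProj hi
  have hCi : ContDiffOn ℝ ∞ (cylDeriv (fun _ => horizontalProj (cylBasis i)) h) 𝕂 := contDiffOn_cylDeriv contDiff_const hh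
  have hid : EqOn (cylDeriv (fun _ => cylBasis i) (cylDeriv Pf h))
      (fun x => cylDeriv Pf (cylDeriv (fun _ => cylBasis i) h) x + cylDeriv (fun _ => horizontalProj (cylBasis i)) h x) 𝕂 := by
    intro x hx
    have h1 := cylDeriv_cylBasis_horizontalProj_sub i hh hx
    dsimp only
    rw [← h1]
    abel
  have e1 : cellL2 L (cylDeriv (fun _ => cylBasis i) (cylDeriv Pf h)) =
      cellL2 L (fun x => cylDeriv Pf (cylDeriv (fun _ => cylBasis i) h) x + cylDeriv (fun _ => horizontalProj (cylBasis i)) h x) := by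
    simp only [cellL2]
    congr 1
    exact eLpNorm_congr_ae (ae_restrict_of_forall_mem (cylinderCell L).isOpen.measurableSet
      fun x hx => hid (subset_closure (cylinderCell_le_unitCylinder L hx)))
  rw [e1]
  refine (cellL2_add_le L hPi.continuousOn hCi.continuousOn).trans (add_le_add (cellL2_cylDeriv_P_le L hi) ?_)
  refine cellL2_mono L (contDiffOn_cylGrad hh).continuousOn fun x _ => ?_
  calc ‖cylDeriv (fun _ => horizontalProj (cylBasis i)) h x‖
      ≤ ‖horizontalProj (cylBasis i)‖ * ‖fderivWithin ℝ h 𝕂 x‖ := norm_cylDeriv_le _ h x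
    _ ≤ 1 * ‖cylGrad h x‖ := by
        rw [norm_cylGrad]
        refine mul_le_mul_of_nonneg_right ?_ (norm_nonneg _)
        rw [norm_horizontalProj]
        exact (cylRadius_le_norm_aux _).trans (norm_cylBasis i).le
    _ = ‖cylGrad h x‖ := one_mul _

end Sizes

/-! ### Tangential words through `P^a J^j E^e`, and the lists `J^j E^e` -/

/-- A tangential word passes through `P^a J^j E^e`. [folklore] -/
theorem cylWord_tanWord_cylWord_pje (β : List Bool) (a j e : ℕ) {f : ℝ³ → F} (hf : ContDiffOn ℝ ∞ f 𝕂) :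
    EqOn (cylWord (tanWord β) (cylWord (List.replicate a Pf ++ List.replicate j rotGen ++ List.replicate e Ef) f))
      (cylWord (List.replicate a Pf ++ List.replicate j rotGen ++ List.replicate e Ef) (cylWord (tanWord β) f)) 𝕂 := by
  induction β with
  | nil => exact fun _ _ => rfl
  | cons b β ih =>
    intro x hx
    rw [tanWord_cons, cylWord_cons, cylWord_cons, cylDeriv_congr ih hx]
    exact cylDeriv_tanField_cylWord_pje b a j e (contDiffOn_cylWord_tanWord β hf) hx

/-- `tanWord (true^j ++ false^e) = J^j ++ E^e`. [folklore] -/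
theorem tanWord_replicate (j e : ℕ) :
    tanWord (List.replicate j true ++ List.replicate e false) = List.replicate j rotGen ++ List.replicate e Ef := by
  simp [tanWord, List.map_append, List.map_replicate, tanField]

/-- `P^a J^j E^e f = P^a (Z^{τ(j,e)} f)` with `τ(j, e) = true^j ++ false^e`. [folklore] -/
theorem cylWord_pje_eq (a j e : ℕ) (f : ℝ³ → F) :
    cylWord (List.replicate a Pf ++ List.replicate j rotGen ++ List.replicate e Ef) f =
      cylWord (List.replicate a Pf) (cylWord (tanWord (List.replicate j true ++ List.replicate e false)) f) := by
  rw [List.append_assoc, cylWord_append, tanWord_replicate]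

/-! ### The data size -/

/-- The tangential lists of length `≤ 2`. [folklore] -/
def tanLists₂ : Finset (List Bool) :=
  {[], [true], [false], [true, true], [true, false], [false, true], [false, false]}

/-- The tangential lists of length `≤ 1`. [folklore] -/
def tanLists₁ : Finset (List Bool) := {[], [true], [false]}

/-- Lists `true^j ++ false^e` with `j + e ≤ 2` are in `tanLists₂`. [folklore] -/
theorem replicate_mem_tanLists₂ {j e : ℕ} (h : j + e ≤ 2) :
    List.replicate j true ++ List.replicate e false ∈ tanLists₂ := by
  have hj : j ≤ 2 := by omega
  have he : e ≤ 2 := by omega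
  interval_cases j <;> interval_cases e <;> simp_all [tanLists₂]

/-- Lists `true^j ++ false^e` with `j + e ≤ 1` are in `tanLists₁`. [folklore] -/
theorem replicate_mem_tanLists₁ {j e : ℕ} (h : j + e ≤ 1) :
    List.replicate j true ++ List.replicate e false ∈ tanLists₁ := by
  have hj : j ≤ 1 := by omega
  have he : e ≤ 1 := by omega
  interval_cases j <;> interval_cases e <;> simp_all [tanLists₁]

/-- A list of length `≤ 2` is in `tanLists₂`. [folklore] -/
theorem mem_tanLists₂_of_length_le {β : List Bool} (h : β.length ≤ 2) : β ∈ tanLists₂ := by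
  match β, h with
  | [], _ => simp [tanLists₂]
  | [b], _ => cases b <;> simp [tanLists₂]
  | [b, c], _ => cases b <;> cases c <;> simp [tanLists₂]

/-- **The data size of the Neumann problem** (real, through `cellL2`): tangential words of `Δ_K q` of
length `≤ 2`, `∇` and values of tangential words of `G` of length `≤ 2`, `∇` of tangential words of
`Δ_K q` of length `≤ 1`, and `∇∂ᵢΔ_K q` — every term a word of order `≤ 2` of `Δ_K q` or of order `≤ 3`
of `G`. [folklore] -/
def neumannData (L : ℝ) (q G : ℝ³ → ℝ) : ℝ :=
  (∑ β ∈ tanLists₂, (cellL2 L (cylWord (tanWord β) (cylLap q)) + cellL2 L (cylGrad (cylWord (tanWord β) G)) +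
    cellL2 L (cylWord (tanWord β) G))) +
  (∑ β ∈ tanLists₁, cellL2 L (cylGrad (cylWord (tanWord β) (cylLap q)))) +
  ∑ i : Fin 3, cellL2 L (cylGrad (cylDeriv (fun _ => cylBasis i) (cylLap q)))

section Data

variable {L : ℝ} {q G : ℝ³ → ℝ}

/-- The data size is nonnegative. [folklore] -/
theorem neumannData_nonneg : 0 ≤ neumannData L q G := by
  unfold neumannData
  refine add_nonneg (add_nonneg (Finset.sum_nonneg fun β _ => ?_) (Finset.sum_nonneg fun β _ => cellL2_nonneg L _))
    (Finset.sum_nonneg fun i _ => cellL2_nonneg L _)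
  have := cellL2_nonneg L (cylWord (tanWord β) (cylLap q))
  have := cellL2_nonneg L (cylGrad (cylWord (tanWord β) G))
  have := cellL2_nonneg L (cylWord (tanWord β) G)
  positivity

/-- One term: `cellL2 (Z^β Δq) ≤ 𝒟` for `|β| ≤ 2`. [folklore] -/
theorem cellL2_tanWord_cylLap_le_data {β : List Bool} (hβ : β ∈ tanLists₂) :
    cellL2 L (cylWord (tanWord β) (cylLap q)) ≤ neumannData L q G := by
  unfold neumannData
  have h1 : cellL2 L (cylWord (tanWord β) (cylLap q)) ≤
      cellL2 L (cylWord (tanWord β) (cylLap q)) + cellL2 L (cylGrad (cylWord (tanWord β) G)) +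
        cellL2 L (cylWord (tanWord β) G) := by
    have := cellL2_nonneg L (cylGrad (cylWord (tanWord β) G)); have := cellL2_nonneg L (cylWord (tanWord β) G)
    linarith
  have h2 := Finset.single_le_sum (f := fun β => cellL2 L (cylWord (tanWord β) (cylLap q)) +
      cellL2 L (cylGrad (cylWord (tanWord β) G)) + cellL2 L (cylWord (tanWord β) G))
    (fun β _ => by
      have := cellL2_nonneg L (cylWord (tanWord β) (cylLap q))
      have := cellL2_nonneg L (cylGrad (cylWord (tanWord β) G)); have := cellL2_nonneg L (cylWord (tanWord β) G)
      positivity) hβ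
  have h3 : 0 ≤ ∑ β ∈ tanLists₁, cellL2 L (cylGrad (cylWord (tanWord β) (cylLap q))) :=
    Finset.sum_nonneg fun β _ => cellL2_nonneg L _
  have h4 : 0 ≤ ∑ i : Fin 3, cellL2 L (cylGrad (cylDeriv (fun _ => cylBasis i) (cylLap q))) :=
    Finset.sum_nonneg fun i _ => cellL2_nonneg L _
  linarith

/-- One term: `cellL2 (∇ Z^β G) ≤ 𝒟` for `|β| ≤ 2`. [folklore] -/
theorem cellL2_cylGrad_tanWord_G_le_data {β : List Bool} (hβ : β ∈ tanLists₂) :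
    cellL2 L (cylGrad (cylWord (tanWord β) G)) ≤ neumannData L q G := by
  unfold neumannData
  have h2 := Finset.single_le_sum (f := fun β => cellL2 L (cylWord (tanWord β) (cylLap q)) +
      cellL2 L (cylGrad (cylWord (tanWord β) G)) + cellL2 L (cylWord (tanWord β) G))
    (fun β _ => by
      have := cellL2_nonneg L (cylWord (tanWord β) (cylLap q))
      have := cellL2_nonneg L (cylGrad (cylWord (tanWord β) G)); have := cellL2_nonneg L (cylWord (tanWord β) G)
      positivity) hβ
  have h3 : 0 ≤ ∑ β ∈ tanLists₁, cellL2 L (cylGrad (cylWord (tanWord β) (cylLap q))) :=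
    Finset.sum_nonneg fun β _ => cellL2_nonneg L _
  have h4 : 0 ≤ ∑ i : Fin 3, cellL2 L (cylGrad (cylDeriv (fun _ => cylBasis i) (cylLap q))) :=
    Finset.sum_nonneg fun i _ => cellL2_nonneg L _
  have := cellL2_nonneg L (cylWord (tanWord β) (cylLap q)); have := cellL2_nonneg L (cylWord (tanWord β) G)
  linarith

/-- One term: `cellL2 (Z^β G) ≤ 𝒟` for `|β| ≤ 2`. [folklore] -/
theorem cellL2_tanWord_G_le_data {β : List Bool} (hβ : β ∈ tanLists₂) :
    cellL2 L (cylWord (tanWord β) G) ≤ neumannData L q G := by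
  unfold neumannData
  have h2 := Finset.single_le_sum (f := fun β => cellL2 L (cylWord (tanWord β) (cylLap q)) +
      cellL2 L (cylGrad (cylWord (tanWord β) G)) + cellL2 L (cylWord (tanWord β) G))
    (fun β _ => by
      have := cellL2_nonneg L (cylWord (tanWord β) (cylLap q))
      have := cellL2_nonneg L (cylGrad (cylWord (tanWord β) G)); have := cellL2_nonneg L (cylWord (tanWord β) G)
      positivity) hβ
  have h3 : 0 ≤ ∑ β ∈ tanLists₁, cellL2 L (cylGrad (cylWord (tanWord β) (cylLap q))) :=
    Finset.sum_nonneg fun β _ => cellL2_nonneg L _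
  have h4 : 0 ≤ ∑ i : Fin 3, cellL2 L (cylGrad (cylDeriv (fun _ => cylBasis i) (cylLap q))) :=
    Finset.sum_nonneg fun i _ => cellL2_nonneg L _
  have := cellL2_nonneg L (cylWord (tanWord β) (cylLap q)); have := cellL2_nonneg L (cylGrad (cylWord (tanWord β) G))
  linarith

/-- One term: `cellL2 (∇ Z^β Δq) ≤ 𝒟` for `|β| ≤ 1`. [folklore] -/
theorem cellL2_cylGrad_tanWord_cylLap_le_data {β : List Bool} (hβ : β ∈ tanLists₁) :
    cellL2 L (cylGrad (cylWord (tanWord β) (cylLap q))) ≤ neumannData L q G := by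
  unfold neumannData
  have h1 : 0 ≤ ∑ β ∈ tanLists₂, (cellL2 L (cylWord (tanWord β) (cylLap q)) +
      cellL2 L (cylGrad (cylWord (tanWord β) G)) + cellL2 L (cylWord (tanWord β) G)) :=
    Finset.sum_nonneg fun β _ => by
      have := cellL2_nonneg L (cylWord (tanWord β) (cylLap q))
      have := cellL2_nonneg L (cylGrad (cylWord (tanWord β) G)); have := cellL2_nonneg L (cylWord (tanWord β) G)
      positivity
  have h2 := Finset.single_le_sum (f := fun β => cellL2 L (cylGrad (cylWord (tanWord β) (cylLap q))))
    (fun β _ => cellL2_nonneg L _) hβ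
  have h4 : 0 ≤ ∑ i : Fin 3, cellL2 L (cylGrad (cylDeriv (fun _ => cylBasis i) (cylLap q))) :=
    Finset.sum_nonneg fun i _ => cellL2_nonneg L _
  linarith

/-- One term: `cellL2 (∇ ∂ᵢ Δq) ≤ 𝒟`. [folklore] -/
theorem cellL2_cylGrad_basis_cylLap_le_data (i : Fin 3) :
    cellL2 L (cylGrad (cylDeriv (fun _ => cylBasis i) (cylLap q))) ≤ neumannData L q G := by
  unfold neumannData
  have h1 : 0 ≤ ∑ β ∈ tanLists₂, (cellL2 L (cylWord (tanWord β) (cylLap q)) +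
      cellL2 L (cylGrad (cylWord (tanWord β) G)) + cellL2 L (cylWord (tanWord β) G)) :=
    Finset.sum_nonneg fun β _ => by
      have := cellL2_nonneg L (cylWord (tanWord β) (cylLap q))
      have := cellL2_nonneg L (cylGrad (cylWord (tanWord β) G)); have := cellL2_nonneg L (cylWord (tanWord β) G)
      positivity
  have h3 : 0 ≤ ∑ β ∈ tanLists₁, cellL2 L (cylGrad (cylWord (tanWord β) (cylLap q))) :=
    Finset.sum_nonneg fun β _ => cellL2_nonneg L _
  have h2 := Finset.single_le_sum (f := fun i : Fin 3 => cellL2 L (cylGrad (cylDeriv (fun _ => cylBasis i) (cylLap q))))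
    (fun i _ => cellL2_nonneg L _) (Finset.mem_univ i)
  linarith

end Data

/-! ### The frame words of `q` by the data -/

section Main

variable {L : ℝ} (hL : 0 < L) {q G : ℝ³ → ℝ} (hq : ContDiffOn ℝ ∞ q 𝕂) (hG : ContDiffOn ℝ ∞ G 𝕂)
  (hqp : IsAxiallyPeriodic L q) (hGp : IsAxiallyPeriodic L G)
  (hN : ∀ x ∈ frontier (unitCylinder : Set ℝ³), cylDeriv Pf q x = G x)

include hL hq hG hqp hGp hN

/-- **`∇` of tangential words of length `≤ 3` by the data** (the tree's tangential and base
estimates): `cellL2 (∇ Z^β q) ≤ (3 C₁ + 5) 𝒟`, `C₁` the constant of the base estimate. [folklore] -/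
theorem cellL2_cylGrad_tanWord_le_data {C₁ : ℝ} (hC₁0 : 0 ≤ C₁)
    (hC₁ : ∀ (q G : ℝ³ → ℝ), ContDiffOn ℝ ∞ q 𝕂 → ContDiffOn ℝ ∞ G 𝕂 →
      IsAxiallyPeriodic L q → IsAxiallyPeriodic L G →
      (∀ x ∈ frontier (unitCylinder : Set ℝ³), cylDeriv (fun y => horizontalProj y) q x = G x) →
      cellL2 L (cylGrad q) ≤ C₁ * (cellL2 L (cylLap q) + cellL2 L (cylGrad G) + cellL2 L G))
    (β : List Bool) (hβ : β.length ≤ 3) :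
    cellL2 L (cylGrad (cylWord (tanWord β) q)) ≤ (3 * C₁ + 5) * neumannData L q G := by
  have hD0 : 0 ≤ neumannData L q G := neumannData_nonneg
  cases β with
  | nil =>
    rw [tanWord_nil, cylWord_nil]
    have h := hC₁ q G hq hG hqp hGp hN
    have h1 : cellL2 L (cylLap q) ≤ neumannData L q G := by
      have := cellL2_tanWord_cylLap_le_data (L := L) (q := q) (G := G) (β := []) (by simp [tanLists₂])
      simpa using this
    have h2 : cellL2 L (cylGrad G) ≤ neumannData L q G := by
      have := cellL2_cylGrad_tanWord_G_le_data (L := L) (q := q) (G := G) (β := []) (by simp [tanLists₂])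
      simpa using this
    have h3 : cellL2 L G ≤ neumannData L q G := by
      have := cellL2_tanWord_G_le_data (L := L) (q := q) (G := G) (β := []) (by simp [tanLists₂])
      simpa using this
    calc cellL2 L (cylGrad q) ≤ C₁ * (cellL2 L (cylLap q) + cellL2 L (cylGrad G) + cellL2 L G) := h
      _ ≤ C₁ * (3 * neumannData L q G) := mul_le_mul_of_nonneg_left (by linarith) hC₁0
      _ ≤ (3 * C₁ + 5) * neumannData L q G := by nlinarith
  | cons b β' =>
    have hβ' : β'.length ≤ 2 := by simp only [List.length_cons] at hβ; omega
    have hmem : β' ∈ tanLists₂ := mem_tanLists₂_of_length_le hβ'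
    have h := cellL2_cylGrad_tanWord_le hL hq hG hqp hGp hN b β'
    have h1 := cellL2_tanWord_cylLap_le_data (L := L) (q := q) (G := G) hmem
    have h2 := cellL2_cylGrad_tanWord_G_le_data (L := L) (q := q) (G := G) hmem
    have h3 := cellL2_tanWord_G_le_data (L := L) (q := q) (G := G) hmem
    calc _ ≤ _ := h
      _ ≤ 5 * neumannData L q G := by linarith
      _ ≤ (3 * C₁ + 5) * neumannData L q G := by nlinarith

/-! #### Helpers -/

omit [NormedSpace ℝ F] hL hq hG hqp hGp hN in
/-- `cellL2` only sees the values on the closed cylinder. [folklore] -/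
theorem cellL2_congr_K {f g : ℝ³ → F} (h : EqOn f g 𝕂) : cellL2 L f = cellL2 L g := by
  simp only [cellL2]
  congr 1
  exact eLpNorm_congr_ae (ae_restrict_of_forall_mem (cylinderCell L).isOpen.measurableSet
    fun x hx => h (subset_closure (cylinderCell_le_unitCylinder L hx)))

omit [NormedSpace ℝ F] hL hq hG hqp hGp hN in
/-- `cellL2 (f − g) ≤ cellL2 f + cellL2 g` for functions continuous on the closed cylinder. [folklore] -/
theorem cellL2_sub_le {f g : ℝ³ → F} (hf : ContinuousOn f 𝕂) (hg : ContinuousOn g 𝕂) :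
    cellL2 L (fun x => f x - g x) ≤ cellL2 L f + cellL2 L g := by
  have hg' : ContinuousOn (fun x => -g x) 𝕂 := hg.neg
  have h := cellL2_add_le L hf hg'
  have e : cellL2 L (fun x => -g x) = cellL2 L g := by
    rw [cellL2, cellL2]
    congr 1
    exact eLpNorm_neg g 2 _
  rw [e] at h
  simpa only [sub_eq_add_neg] using h

omit hL hq hG hqp hGp hN in
/-- `cellL2 (c • f) ≤ |c| cellL2 f` (equality, recorded as the inequality used). [folklore] -/
theorem cellL2_smul_le (c : ℝ) (f : ℝ³ → F) : cellL2 L (fun x => c • f x) ≤ |c| * cellL2 L f :=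
  (cellL2_const_smul L c f).le

omit hL hq hG hqp hGp hN in
/-- `P (r² A − B) = 2r² A + r² P A − P B` on the closed cylinder. [folklore] -/
theorem cylDeriv_P_sqRadius_sub {A B : ℝ³ → F} (hA : ContDiffOn ℝ ∞ A 𝕂) (hB : ContDiffOn ℝ ∞ B 𝕂)
    {x : ℝ³} (hx : x ∈ 𝕂) :
    cylDeriv Pf (fun y : ℝ³ => (y 0 ^ 2 + y 1 ^ 2) • A y - B y) x =
      (2 * (x 0 ^ 2 + x 1 ^ 2)) • A x + (x 0 ^ 2 + x 1 ^ 2) • cylDeriv Pf A x - cylDeriv Pf B x := by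
  have hρ : ContDiffOn ℝ ∞ (fun y : ℝ³ => y 0 ^ 2 + y 1 ^ 2) 𝕂 :=
    (((contDiff_cylCoordFun 0).pow 2).add ((contDiff_cylCoordFun 1).pow 2)).contDiffOn
  have hρA : ContDiffOn ℝ ∞ (fun y : ℝ³ => (y 0 ^ 2 + y 1 ^ 2) • A y) 𝕂 := hρ.smul hA
  rw [cylDeriv_sub hρA hB hx, cylDeriv_P_sqRadius_smul hA hx]

omit hL hq hG hqp hGp hN in
/-- Smoothness of `r² A − B`. [folklore] -/
theorem contDiffOn_sqRadius_smul_sub {A B : ℝ³ → F} (hA : ContDiffOn ℝ ∞ A 𝕂) (hB : ContDiffOn ℝ ∞ B 𝕂) :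
    ContDiffOn ℝ ∞ (fun y : ℝ³ => (y 0 ^ 2 + y 1 ^ 2) • A y - B y) 𝕂 :=
  ((((contDiff_cylCoordFun 0).pow 2).add ((contDiff_cylCoordFun 1).pow 2)).contDiffOn.smul hA).sub hB

omit hL hq hG hqp hGp hN in
/-- `cellL2 (r² A − B) ≤ cellL2 A + cellL2 B`. [folklore] -/
theorem cellL2_sqRadius_smul_sub_le {A B : ℝ³ → F} (hA : ContinuousOn A 𝕂) (hB : ContinuousOn B 𝕂) :
    cellL2 L (fun y : ℝ³ => (y 0 ^ 2 + y 1 ^ 2) • A y - B y) ≤ cellL2 L A + cellL2 L B := by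
  have hρ : ContinuousOn (fun y : ℝ³ => (y 0 ^ 2 + y 1 ^ 2) • A y) 𝕂 :=
    ((((contDiff_cylCoordFun 0).pow 2).add ((contDiff_cylCoordFun 1).pow 2)).continuous.continuousOn).smul hA
  exact (cellL2_sub_le hρ hB).trans (add_le_add (cellL2_sqRadius_smul_le L hA) le_rfl)

/-! #### The normal form `P² f = r²(Δf − E²f) − J²f` inside a tangential word -/

omit hL hG hqp hGp hN in
/-- `Z^τ (P P q) = r² (Z^τ Δq − Z^τ E E q) − Z^τ J J q` on the closed cylinder. [folklore] -/
theorem cylWord_tanWord_P_P_eq (τ : List Bool) :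
    EqOn (cylWord (tanWord τ) (cylDeriv Pf (cylDeriv Pf q)))
      (fun x => (x 0 ^ 2 + x 1 ^ 2) • (cylWord (tanWord τ) (cylLap q) x -
        cylWord (tanWord τ) (cylDeriv Ef (cylDeriv Ef q)) x) -
        cylWord (tanWord τ) (cylDeriv rotGen (cylDeriv rotGen q)) x) 𝕂 := by
  set A : ℝ³ → ℝ := fun y => cylLap q y - cylDeriv Ef (cylDeriv Ef q) y with hA_def
  set B : ℝ³ → ℝ := cylDeriv rotGen (cylDeriv rotGen q) with hB_def
  set R : ℝ³ → ℝ := fun y => (y 0 ^ 2 + y 1 ^ 2) • A y with hR_def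
  have hLq : ContDiffOn ℝ ∞ (cylLap q) 𝕂 := contDiffOn_cylLap hq
  have hEE : ContDiffOn ℝ ∞ (cylDeriv Ef (cylDeriv Ef q)) 𝕂 :=
    contDiffOn_cylDeriv contDiff_const (contDiffOn_cylDeriv contDiff_const hq)
  have hBs : ContDiffOn ℝ ∞ B 𝕂 := contDiffOn_cylDeriv contDiff_rotGen (contDiffOn_cylDeriv contDiff_rotGen hq)
  have hAs : ContDiffOn ℝ ∞ A 𝕂 := hLq.sub hEE
  have hRs : ContDiffOn ℝ ∞ R 𝕂 :=
    (((contDiff_cylCoordFun 0).pow 2).add ((contDiff_cylCoordFun 1).pow 2)).contDiffOn.smul hAs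
  have h1 : EqOn (cylDeriv Pf (cylDeriv Pf q)) (fun y => R y - B y) 𝕂 := fun y hy => by
    simp only [hR_def, hA_def, hB_def]
    exact cylDeriv_P_P_eq hq hy
  have h2 : EqOn (cylWord (tanWord τ) (fun y => R y - B y))
      (fun y => cylWord (tanWord τ) R y - cylWord (tanWord τ) B y) 𝕂 := cylWord_tanWord_sub τ hRs hBs
  have h3 : EqOn (cylWord (tanWord τ) R) (fun x => (x 0 ^ 2 + x 1 ^ 2) • cylWord (tanWord τ) A x) 𝕂 :=
    cylWord_tanWord_sqRadius_smul τ hAs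
  have h4 : EqOn (cylWord (tanWord τ) A)
      (fun y => cylWord (tanWord τ) (cylLap q) y - cylWord (tanWord τ) (cylDeriv Ef (cylDeriv Ef q)) y) 𝕂 :=
    cylWord_tanWord_sub τ hLq hEE
  intro x hx
  rw [cylWord_congr (tanWord τ) h1 hx, h2 hx]
  show cylWord (tanWord τ) R x - cylWord (tanWord τ) B x = _
  rw [h3 hx]
  show (x 0 ^ 2 + x 1 ^ 2) • cylWord (tanWord τ) A x - cylWord (tanWord τ) B x = _
  rw [h4 hx]

/-! #### The bounds by number of radial letters -/

omit hL hq hG hqp hGp hN in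
/-- `tanWord` of a concatenation. [folklore] -/
theorem tanWord_append' (β β' : List Bool) : tanWord (β ++ β') = tanWord β ++ tanWord β' := by
  simp [tanWord]

omit hL hq hG hqp hGp hN in
/-- `Z^τ (E E q) = J^j E^{e+2} q` for `τ = τ(j, e)`. [folklore] -/
theorem cylWord_tanWord_E_E_eq (j e : ℕ) :
    cylWord (tanWord (List.replicate j true ++ List.replicate e false)) (cylDeriv Ef (cylDeriv Ef q)) =
      cylWord (List.replicate 0 Pf ++ List.replicate j rotGen ++ List.replicate (e + 2) Ef) q := by
  conv_rhs => rw [cylWord_pje_eq, List.replicate_zero, cylWord_nil, List.replicate_add, ← List.append_assoc,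
    tanWord_append', cylWord_append]
  rfl

omit hL hG hqp hGp hN in
/-- `Z^τ (J J q) = J^{j+2} E^e q` on the closed cylinder for `τ = τ(j, e)`. [folklore] -/
theorem cylWord_tanWord_J_J_eqOn (j e : ℕ) :
    EqOn (cylWord (tanWord (List.replicate j true ++ List.replicate e false)) (cylDeriv rotGen (cylDeriv rotGen q)))
      (cylWord (List.replicate 0 Pf ++ List.replicate (j + 2) rotGen ++ List.replicate e Ef) q) 𝕂 := by
  intro x hx
  have h := cylWord_tanWord_cylWord_pje (List.replicate j true ++ List.replicate e false) 0 2 0 hq hx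
  simp only [List.replicate_zero, List.nil_append, List.append_nil] at h
  have h2 : cylWord (List.replicate 2 rotGen) q = cylDeriv rotGen (cylDeriv rotGen q) := rfl
  rw [h2] at h
  rw [h, List.replicate_zero, List.nil_append, Nat.add_comm, List.replicate_add, List.append_assoc,
    cylWord_append, tanWord_replicate]

omit hL hG hqp hGp hN in
/-- **No radial letter**: `cellL2 (J^j E^e q) ≤ C₀ 𝒟` for `1 ≤ j + e ≤ 4`. [folklore] -/
theorem cellL2_pje_zero_le {C₀ : ℝ}
    (hT : ∀ β : List Bool, β.length ≤ 3 → cellL2 L (cylGrad (cylWord (tanWord β) q)) ≤ C₀ * neumannData L q G)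
    (j e : ℕ) (h1 : 1 ≤ j + e) (h4 : j + e ≤ 4) :
    cellL2 L (cylWord (List.replicate 0 Pf ++ List.replicate j rotGen ++ List.replicate e Ef) q) ≤
      C₀ * neumannData L q G := by
  rw [cylWord_pje_eq, List.replicate_zero, cylWord_nil]
  rcases j with _ | j'
  · obtain ⟨e', rfl⟩ : ∃ e', e = e' + 1 := ⟨e - 1, by omega⟩
    rw [List.replicate_zero, List.nil_append, List.replicate_succ, tanWord_cons, cylWord_cons]
    refine (cellL2_cylDeriv_tanField_le L false (contDiffOn_cylWord_tanWord _ hq)).trans ?_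
    exact hT _ (by simp only [List.length_replicate]; omega)
  · rw [List.replicate_succ, List.cons_append, tanWord_cons, cylWord_cons]
    refine (cellL2_cylDeriv_tanField_le L true (contDiffOn_cylWord_tanWord _ hq)).trans ?_
    exact hT _ (by simp only [List.length_append, List.length_replicate]; omega)

omit hL hG hqp hGp hN in
/-- **One radial letter**: `cellL2 (P J^j E^e q) ≤ C₀ 𝒟` for `j + e ≤ 3`. [folklore] -/
theorem cellL2_pje_one_le {C₀ : ℝ}
    (hT : ∀ β : List Bool, β.length ≤ 3 → cellL2 L (cylGrad (cylWord (tanWord β) q)) ≤ C₀ * neumannData L q G)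
    (j e : ℕ) (h3 : j + e ≤ 3) :
    cellL2 L (cylWord (List.replicate 1 Pf ++ List.replicate j rotGen ++ List.replicate e Ef) q) ≤
      C₀ * neumannData L q G := by
  rw [cylWord_pje_eq]
  show cellL2 L (cylDeriv Pf (cylWord (tanWord (List.replicate j true ++ List.replicate e false)) q)) ≤ _
  refine (cellL2_cylDeriv_P_le L (contDiffOn_cylWord_tanWord _ hq)).trans ?_
  exact hT _ (by simp only [List.length_append, List.length_replicate]; omega)

omit hL hG hqp hGp hN in
/-- **Two radial letters**: `cellL2 (P P J^j E^e q) ≤ (1 + 2C₀) 𝒟` for `j + e ≤ 2`, from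
`P² = r²(Δ − E²) − J²` inside the tangential word. [folklore] -/
theorem cellL2_pje_two_le {C₀ : ℝ}
    (hT : ∀ β : List Bool, β.length ≤ 3 → cellL2 L (cylGrad (cylWord (tanWord β) q)) ≤ C₀ * neumannData L q G)
    (j e : ℕ) (h2 : j + e ≤ 2) :
    cellL2 L (cylWord (List.replicate 2 Pf ++ List.replicate j rotGen ++ List.replicate e Ef) q) ≤
      (1 + 2 * C₀) * neumannData L q G := by
  set τ : List Bool := List.replicate j true ++ List.replicate e false with hτ
  have hτmem : τ ∈ tanLists₂ := replicate_mem_tanLists₂ h2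
  have hcomm : EqOn (cylWord (List.replicate 2 Pf ++ List.replicate j rotGen ++ List.replicate e Ef) q)
      (cylWord (tanWord τ) (cylDeriv Pf (cylDeriv Pf q))) 𝕂 := by
    intro x hx
    rw [cylWord_pje_eq]
    have h := cylWord_tanWord_cylWord_pje τ 2 0 0 hq hx
    simp only [List.replicate_zero, List.append_nil] at h
    rw [← h]
    rfl
  rw [cellL2_congr_K hcomm, cellL2_congr_K (cylWord_tanWord_P_P_eq hq τ)]
  have hLq : ContDiffOn ℝ ∞ (cylLap q) 𝕂 := contDiffOn_cylLap hq
  have hEE : ContDiffOn ℝ ∞ (cylDeriv Ef (cylDeriv Ef q)) 𝕂 :=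
    contDiffOn_cylDeriv contDiff_const (contDiffOn_cylDeriv contDiff_const hq)
  have hJJ : ContDiffOn ℝ ∞ (cylDeriv rotGen (cylDeriv rotGen q)) 𝕂 :=
    contDiffOn_cylDeriv contDiff_rotGen (contDiffOn_cylDeriv contDiff_rotGen hq)
  have hA : ContinuousOn (fun x => cylWord (tanWord τ) (cylLap q) x - cylWord (tanWord τ) (cylDeriv Ef (cylDeriv Ef q)) x) 𝕂 :=
    ((contDiffOn_cylWord_tanWord τ hLq).sub (contDiffOn_cylWord_tanWord τ hEE)).continuousOn
  have hB : ContinuousOn (cylWord (tanWord τ) (cylDeriv rotGen (cylDeriv rotGen q))) 𝕂 :=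
    (contDiffOn_cylWord_tanWord τ hJJ).continuousOn
  have hD0 : 0 ≤ neumannData L q G := neumannData_nonneg
  -- the three pieces
  have p1 : cellL2 L (cylWord (tanWord τ) (cylLap q)) ≤ neumannData L q G := cellL2_tanWord_cylLap_le_data hτmem
  have p2 : cellL2 L (cylWord (tanWord τ) (cylDeriv Ef (cylDeriv Ef q))) ≤ C₀ * neumannData L q G := by
    rw [hτ, cylWord_tanWord_E_E_eq j e]
    exact cellL2_pje_zero_le hq hT j (e + 2) (by omega) (by omega)
  have p3 : cellL2 L (cylWord (tanWord τ) (cylDeriv rotGen (cylDeriv rotGen q))) ≤ C₀ * neumannData L q G := by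
    rw [hτ, cellL2_congr_K (cylWord_tanWord_J_J_eqOn hq j e)]
    exact cellL2_pje_zero_le hq hT (j + 2) e (by omega) (by omega)
  calc _ ≤ cellL2 L (fun x => cylWord (tanWord τ) (cylLap q) x - cylWord (tanWord τ) (cylDeriv Ef (cylDeriv Ef q)) x) +
        cellL2 L (cylWord (tanWord τ) (cylDeriv rotGen (cylDeriv rotGen q))) := cellL2_sqRadius_smul_sub_le hA hB
    _ ≤ (cellL2 L (cylWord (tanWord τ) (cylLap q)) + cellL2 L (cylWord (tanWord τ) (cylDeriv Ef (cylDeriv Ef q)))) +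
        cellL2 L (cylWord (tanWord τ) (cylDeriv rotGen (cylDeriv rotGen q))) :=
        add_le_add (cellL2_sub_le (contDiffOn_cylWord_tanWord τ hLq).continuousOn
          (contDiffOn_cylWord_tanWord τ hEE).continuousOn) le_rfl
    _ ≤ neumannData L q G + C₀ * neumannData L q G + C₀ * neumannData L q G := add_le_add (add_le_add p1 p2) p3
    _ = (1 + 2 * C₀) * neumannData L q G := by ring

omit hL hG hqp hGp hN in
/-- **Three radial letters**: `cellL2 (P P P J^j E^e q) ≤ (3 + 4C₀) 𝒟` for `j + e ≤ 1`
(`P(r²A − B) = 2r²A + r²PA − PB`). [folklore] -/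
theorem cellL2_pje_three_le {C₀ : ℝ}
    (hT : ∀ β : List Bool, β.length ≤ 3 → cellL2 L (cylGrad (cylWord (tanWord β) q)) ≤ C₀ * neumannData L q G)
    (j e : ℕ) (h1 : j + e ≤ 1) :
    cellL2 L (cylWord (List.replicate 3 Pf ++ List.replicate j rotGen ++ List.replicate e Ef) q) ≤
      (3 + 4 * C₀) * neumannData L q G := by
  set τ : List Bool := List.replicate j true ++ List.replicate e false with hτ
  have hτmem : τ ∈ tanLists₁ := replicate_mem_tanLists₁ h1
  have hτmem₂ : τ ∈ tanLists₂ := replicate_mem_tanLists₂ (by omega)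
  have hLq : ContDiffOn ℝ ∞ (cylLap q) 𝕂 := contDiffOn_cylLap hq
  have hEE : ContDiffOn ℝ ∞ (cylDeriv Ef (cylDeriv Ef q)) 𝕂 :=
    contDiffOn_cylDeriv contDiff_const (contDiffOn_cylDeriv contDiff_const hq)
  have hJJ : ContDiffOn ℝ ∞ (cylDeriv rotGen (cylDeriv rotGen q)) 𝕂 :=
    contDiffOn_cylDeriv contDiff_rotGen (contDiffOn_cylDeriv contDiff_rotGen hq)
  set A : ℝ³ → ℝ := fun x => cylWord (tanWord τ) (cylLap q) x - cylWord (tanWord τ) (cylDeriv Ef (cylDeriv Ef q)) x with hA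
  set B : ℝ³ → ℝ := cylWord (tanWord τ) (cylDeriv rotGen (cylDeriv rotGen q)) with hB
  have hAs : ContDiffOn ℝ ∞ A 𝕂 := (contDiffOn_cylWord_tanWord τ hLq).sub (contDiffOn_cylWord_tanWord τ hEE)
  have hBs : ContDiffOn ℝ ∞ B 𝕂 := contDiffOn_cylWord_tanWord τ hJJ
  -- the word on the closed cylinder
  have hid : EqOn (cylWord (List.replicate 3 Pf ++ List.replicate j rotGen ++ List.replicate e Ef) q)
      (fun x => (2 * (x 0 ^ 2 + x 1 ^ 2)) • A x + (x 0 ^ 2 + x 1 ^ 2) • cylDeriv Pf A x - cylDeriv Pf B x) 𝕂 := by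
    intro x hx
    rw [cylWord_pje_eq]
    have hinner : EqOn (cylWord (List.replicate 2 Pf) (cylWord (tanWord τ) q))
        (fun y => (y 0 ^ 2 + y 1 ^ 2) • A y - B y) 𝕂 := by
      intro y hy
      have h := cylWord_tanWord_cylWord_pje τ 2 0 0 hq hy
      simp only [List.replicate_zero, List.append_nil] at h
      rw [← h]
      exact cylWord_tanWord_P_P_eq hq τ hy
    show cylDeriv Pf (cylWord (List.replicate 2 Pf) (cylWord (tanWord τ) q)) x = _
    rw [cylDeriv_congr hinner hx, cylDeriv_P_sqRadius_sub hAs hBs hx]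
  rw [cellL2_congr_K hid]
  have hD0 : 0 ≤ neumannData L q G := neumannData_nonneg
  -- pieces
  have p1 : cellL2 L (cylWord (tanWord τ) (cylLap q)) ≤ neumannData L q G := cellL2_tanWord_cylLap_le_data hτmem₂
  have p2 : cellL2 L (cylWord (tanWord τ) (cylDeriv Ef (cylDeriv Ef q))) ≤ C₀ * neumannData L q G := by
    rw [hτ, cylWord_tanWord_E_E_eq j e]
    exact cellL2_pje_zero_le hq hT j (e + 2) (by omega) (by omega)
  have pA : cellL2 L A ≤ neumannData L q G + C₀ * neumannData L q G :=
    (cellL2_sub_le (contDiffOn_cylWord_tanWord τ hLq).continuousOn (contDiffOn_cylWord_tanWord τ hEE).continuousOn).trans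
      (add_le_add p1 p2)
  have pPA : cellL2 L (cylDeriv Pf A) ≤ neumannData L q G + C₀ * neumannData L q G := by
    have e1 : EqOn (cylDeriv Pf A) (fun x => cylDeriv Pf (cylWord (tanWord τ) (cylLap q)) x -
        cylDeriv Pf (cylWord (tanWord τ) (cylDeriv Ef (cylDeriv Ef q))) x) 𝕂 := fun x hx =>
      cylDeriv_sub (contDiffOn_cylWord_tanWord τ hLq) (contDiffOn_cylWord_tanWord τ hEE) hx
    rw [cellL2_congr_K e1]
    refine (cellL2_sub_le (contDiffOn_cylDeriv contDiff_horizontalProj (contDiffOn_cylWord_tanWord τ hLq)).continuousOn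
      (contDiffOn_cylDeriv contDiff_horizontalProj (contDiffOn_cylWord_tanWord τ hEE)).continuousOn).trans
      (add_le_add ?_ ?_)
    · exact (cellL2_cylDeriv_P_le L (contDiffOn_cylWord_tanWord τ hLq)).trans (cellL2_cylGrad_tanWord_cylLap_le_data hτmem)
    · rw [hτ, cylWord_tanWord_E_E_eq j e, cylWord_pje_eq, List.replicate_zero, cylWord_nil]
      have h := cellL2_pje_one_le hq hT j (e + 2) (by omega)
      rw [cylWord_pje_eq] at h
      have e2 : cylWord (List.replicate 1 Pf) = fun f : ℝ³ → ℝ => cylDeriv Pf f := by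
        funext f; simp only [List.replicate, cylWord_cons, cylWord_nil]
      rw [e2] at h
      exact h
  have pPB : cellL2 L (cylDeriv Pf B) ≤ C₀ * neumannData L q G := by
    have e1 : EqOn (cylDeriv Pf B) (cylWord (List.replicate 1 Pf ++ List.replicate (j + 2) rotGen ++ List.replicate e Ef) q) 𝕂 := by
      intro x hx
      rw [hB, hτ, cylDeriv_congr (cylWord_tanWord_J_J_eqOn hq j e) hx, cylWord_pje_eq, cylWord_pje_eq,
        List.replicate_zero, cylWord_nil]
      rfl
    rw [cellL2_congr_K e1]
    exact cellL2_pje_one_le hq hT (j + 2) e (by omega)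
  have hc1 : ContinuousOn (fun x : ℝ³ => (2 * (x 0 ^ 2 + x 1 ^ 2)) • A x) 𝕂 :=
    ((continuous_const.mul (((contDiff_cylCoordFun 0).pow 2).add ((contDiff_cylCoordFun 1).pow 2)).continuous).continuousOn).smul
      hAs.continuousOn
  have hc2 : ContinuousOn (fun x : ℝ³ => (x 0 ^ 2 + x 1 ^ 2) • cylDeriv Pf A x) 𝕂 :=
    ((((contDiff_cylCoordFun 0).pow 2).add ((contDiff_cylCoordFun 1).pow 2)).continuous.continuousOn).smul
      (contDiffOn_cylDeriv contDiff_horizontalProj hAs).continuousOn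
  have hc3 : ContinuousOn (cylDeriv Pf B) 𝕂 := (contDiffOn_cylDeriv contDiff_horizontalProj hBs).continuousOn
  have q1 : cellL2 L (fun x : ℝ³ => (2 * (x 0 ^ 2 + x 1 ^ 2)) • A x) ≤ 2 * cellL2 L A := by
    have e : (fun x : ℝ³ => (2 * (x 0 ^ 2 + x 1 ^ 2)) • A x) = fun x => (2 : ℝ) • ((x 0 ^ 2 + x 1 ^ 2) • A x) := by
      funext x; rw [smul_smul]
    rw [e]
    refine (cellL2_smul_le 2 _).trans ?_
    rw [abs_of_pos (by norm_num : (0 : ℝ) < 2)]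
    exact mul_le_mul_of_nonneg_left (cellL2_sqRadius_smul_le L hAs.continuousOn) (by norm_num)
  have q2 : cellL2 L (fun x : ℝ³ => (x 0 ^ 2 + x 1 ^ 2) • cylDeriv Pf A x) ≤ cellL2 L (cylDeriv Pf A) :=
    cellL2_sqRadius_smul_le L (contDiffOn_cylDeriv contDiff_horizontalProj hAs).continuousOn
  calc _ ≤ cellL2 L (fun x : ℝ³ => (2 * (x 0 ^ 2 + x 1 ^ 2)) • A x + (x 0 ^ 2 + x 1 ^ 2) • cylDeriv Pf A x) +
        cellL2 L (cylDeriv Pf B) := cellL2_sub_le (hc1.add hc2) hc3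
    _ ≤ (cellL2 L (fun x : ℝ³ => (2 * (x 0 ^ 2 + x 1 ^ 2)) • A x) +
        cellL2 L (fun x : ℝ³ => (x 0 ^ 2 + x 1 ^ 2) • cylDeriv Pf A x)) + cellL2 L (cylDeriv Pf B) :=
        add_le_add (cellL2_add_le L hc1 hc2) le_rfl
    _ ≤ (2 * (neumannData L q G + C₀ * neumannData L q G) + (neumannData L q G + C₀ * neumannData L q G)) +
        C₀ * neumannData L q G := add_le_add (add_le_add (q1.trans (by linarith)) (q2.trans pPA)) pPB
    _ = (3 + 4 * C₀) * neumannData L q G := by ring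

omit hL hG hqp hGp hN in
/-- **Four radial letters**: `cellL2 (P P P P q) ≤ (16 + 12C₀) 𝒟`
(`P²(r²A₀ − B₀) = 4r²A₀ + 4r²PA₀ + r²P²A₀ − P²B₀`, `A₀ = Δq − E²q`, `B₀ = J²q`). [folklore] -/
theorem cellL2_pje_four_le {C₀ : ℝ}
    (hT : ∀ β : List Bool, β.length ≤ 3 → cellL2 L (cylGrad (cylWord (tanWord β) q)) ≤ C₀ * neumannData L q G) :
    cellL2 L (cylWord (List.replicate 4 Pf ++ List.replicate 0 rotGen ++ List.replicate 0 Ef) q) ≤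
      (16 + 12 * C₀) * neumannData L q G := by
  have hLq : ContDiffOn ℝ ∞ (cylLap q) 𝕂 := contDiffOn_cylLap hq
  have hEE : ContDiffOn ℝ ∞ (cylDeriv Ef (cylDeriv Ef q)) 𝕂 :=
    contDiffOn_cylDeriv contDiff_const (contDiffOn_cylDeriv contDiff_const hq)
  have hJJ : ContDiffOn ℝ ∞ (cylDeriv rotGen (cylDeriv rotGen q)) 𝕂 :=
    contDiffOn_cylDeriv contDiff_rotGen (contDiffOn_cylDeriv contDiff_rotGen hq)
  have hP : ∀ {g : ℝ³ → ℝ}, ContDiffOn ℝ ∞ g 𝕂 → ContDiffOn ℝ ∞ (cylDeriv Pf g) 𝕂 := fun hg =>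
    contDiffOn_cylDeriv contDiff_horizontalProj hg
  set A₀ : ℝ³ → ℝ := fun x => cylLap q x - cylDeriv Ef (cylDeriv Ef q) x with hA₀
  set B₀ : ℝ³ → ℝ := cylDeriv rotGen (cylDeriv rotGen q) with hB₀
  have hA₀s : ContDiffOn ℝ ∞ A₀ 𝕂 := hLq.sub hEE
  set A₁ : ℝ³ → ℝ := fun x => (2 : ℝ) • A₀ x + cylDeriv Pf A₀ x with hA₁
  have hA₁s : ContDiffOn ℝ ∞ A₁ 𝕂 := by
    rw [hA₁]
    exact ((contDiffOn_const (c := (2 : ℝ))).smul hA₀s).add (hP hA₀s)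
  set B₁ : ℝ³ → ℝ := cylDeriv Pf B₀ with hB₁
  have hB₁s : ContDiffOn ℝ ∞ B₁ 𝕂 := hP hJJ
  -- `P P q = r² A₀ − B₀`, `P P P q = r² A₁ − B₁`, `P P P P q = 2r² A₁ + r² P A₁ − P B₁`
  have h2 : EqOn (cylDeriv Pf (cylDeriv Pf q)) (fun y => (y 0 ^ 2 + y 1 ^ 2) • A₀ y - B₀ y) 𝕂 := fun y hy => by
    have h := cylWord_tanWord_P_P_eq hq [] hy
    simpa [tanWord_nil, cylWord_nil] using h
  have h3 : EqOn (cylDeriv Pf (cylDeriv Pf (cylDeriv Pf q))) (fun y => (y 0 ^ 2 + y 1 ^ 2) • A₁ y - B₁ y) 𝕂 := by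
    intro y hy
    rw [cylDeriv_congr h2 hy, cylDeriv_P_sqRadius_sub hA₀s hJJ hy, hA₁, hB₁]
    simp only [smul_eq_mul]
    ring
  have hw : cylWord (List.replicate 4 Pf ++ List.replicate 0 rotGen ++ List.replicate 0 Ef) q =
      cylDeriv Pf (cylDeriv Pf (cylDeriv Pf (cylDeriv Pf q))) := by
    simp only [List.replicate, List.append_nil, cylWord_cons, cylWord_nil]
  have hid : EqOn (cylWord (List.replicate 4 Pf ++ List.replicate 0 rotGen ++ List.replicate 0 Ef) q)
      (fun x => (2 * (x 0 ^ 2 + x 1 ^ 2)) • A₁ x + (x 0 ^ 2 + x 1 ^ 2) • cylDeriv Pf A₁ x - cylDeriv Pf B₁ x) 𝕂 := by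
    intro x hx
    rw [hw, cylDeriv_congr h3 hx, cylDeriv_P_sqRadius_sub hA₁s hB₁s hx]
  rw [cellL2_congr_K hid]
  have hD0 : 0 ≤ neumannData L q G := neumannData_nonneg
  -- pieces: A₀, P A₀, P P A₀, P P B₀
  have pA₀ : cellL2 L A₀ ≤ neumannData L q G + C₀ * neumannData L q G := by
    refine (cellL2_sub_le hLq.continuousOn hEE.continuousOn).trans (add_le_add ?_ ?_)
    · have := cellL2_tanWord_cylLap_le_data (L := L) (q := q) (G := G) (β := []) (by simp [tanLists₂])
      simpa [tanWord_nil, cylWord_nil] using this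
    · have hw0 : cylDeriv Ef (cylDeriv Ef q) = cylWord (List.replicate 0 Pf ++ List.replicate 0 rotGen ++ List.replicate 2 Ef) q := by
        simp only [List.replicate, List.nil_append, cylWord_cons, cylWord_nil]
      rw [hw0]; exact cellL2_pje_zero_le hq hT 0 2 (by omega) (by omega)
  have pPA₀ : cellL2 L (cylDeriv Pf A₀) ≤ neumannData L q G + C₀ * neumannData L q G := by
    have e1 : EqOn (cylDeriv Pf A₀) (fun x => cylDeriv Pf (cylLap q) x - cylDeriv Pf (cylDeriv Ef (cylDeriv Ef q)) x) 𝕂 :=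
      fun x hx => cylDeriv_sub hLq hEE hx
    rw [cellL2_congr_K e1]
    refine (cellL2_sub_le (hP hLq).continuousOn (hP hEE).continuousOn).trans (add_le_add ?_ ?_)
    · refine (cellL2_cylDeriv_P_le L hLq).trans ?_
      have := cellL2_cylGrad_tanWord_cylLap_le_data (L := L) (q := q) (G := G) (β := []) (by simp [tanLists₁])
      simpa [tanWord_nil, cylWord_nil] using this
    · have hw1 : cylDeriv Pf (cylDeriv Ef (cylDeriv Ef q)) =
          cylWord (List.replicate 1 Pf ++ List.replicate 0 rotGen ++ List.replicate 2 Ef) q := by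
        simp only [List.replicate, List.cons_append, List.nil_append, cylWord_cons, cylWord_nil]
      rw [hw1]
      exact cellL2_pje_one_le hq hT 0 2 (by omega)
  have pPPA₀ : cellL2 L (cylDeriv Pf (cylDeriv Pf A₀)) ≤ 6 * neumannData L q G + (1 + 2 * C₀) * neumannData L q G := by
    have e1 : EqOn (cylDeriv Pf (cylDeriv Pf A₀))
        (fun x => cylDeriv Pf (cylDeriv Pf (cylLap q)) x - cylDeriv Pf (cylDeriv Pf (cylDeriv Ef (cylDeriv Ef q))) x) 𝕂 := by
      intro x hx
      have e0 : EqOn (cylDeriv Pf A₀) (fun y => cylDeriv Pf (cylLap q) y - cylDeriv Pf (cylDeriv Ef (cylDeriv Ef q)) y) 𝕂 :=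
        fun y hy => cylDeriv_sub hLq hEE hy
      rw [cylDeriv_congr e0 hx, cylDeriv_sub (hP hLq) (hP hEE) hx]
    rw [cellL2_congr_K e1]
    refine (cellL2_sub_le (hP (hP hLq)).continuousOn (hP (hP hEE)).continuousOn).trans (add_le_add ?_ ?_)
    · -- `‖P P Δq‖ ≤ ‖∇ P Δq‖ ≤ Σᵢ ‖∂ᵢ P Δq‖ ≤ Σᵢ (‖∇∂ᵢΔq‖ + ‖∇Δq‖)`
      have hgrad : cellL2 L (cylGrad (cylLap q)) ≤ neumannData L q G := by
        have := cellL2_cylGrad_tanWord_cylLap_le_data (L := L) (q := q) (G := G) (β := []) (by simp [tanLists₁])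
        simpa [tanWord_nil, cylWord_nil] using this
      calc cellL2 L (cylDeriv Pf (cylDeriv Pf (cylLap q))) ≤ cellL2 L (cylGrad (cylDeriv Pf (cylLap q))) :=
            cellL2_cylDeriv_P_le L (hP hLq)
        _ ≤ ∑ i : Fin 3, cellL2 L (cylDeriv (fun _ => cylBasis i) (cylDeriv Pf (cylLap q))) :=
            cellL2_cylGrad_le_sum L (hP hLq)
        _ ≤ ∑ i : Fin 3, (cellL2 L (cylGrad (cylDeriv (fun _ => cylBasis i) (cylLap q))) + cellL2 L (cylGrad (cylLap q))) :=
            Finset.sum_le_sum fun i _ => cellL2_cylDeriv_basis_P_le L i hLq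
        _ ≤ ∑ _i : Fin 3, (neumannData L q G + neumannData L q G) :=
            Finset.sum_le_sum fun i _ => add_le_add (cellL2_cylGrad_basis_cylLap_le_data i) hgrad
        _ = 6 * neumannData L q G := by
            rw [Finset.sum_const, Finset.card_univ, Fintype.card_fin, nsmul_eq_mul]; ring
    · have hw2 : cylDeriv Pf (cylDeriv Pf (cylDeriv Ef (cylDeriv Ef q))) =
          cylWord (List.replicate 2 Pf ++ List.replicate 0 rotGen ++ List.replicate 2 Ef) q := by
        simp only [List.replicate, List.cons_append, List.nil_append, cylWord_cons, cylWord_nil]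
      rw [hw2]
      exact cellL2_pje_two_le hq hT 0 2 (by omega)
  have pPPB₀ : cellL2 L (cylDeriv Pf B₁) ≤ (1 + 2 * C₀) * neumannData L q G := by
    have hw2 : cylDeriv Pf B₁ = cylWord (List.replicate 2 Pf ++ List.replicate 2 rotGen ++ List.replicate 0 Ef) q := by
      rw [hB₁, hB₀]
      simp only [List.replicate, List.append_nil, List.cons_append, List.nil_append, cylWord_cons, cylWord_nil]
    rw [hw2]
    exact cellL2_pje_two_le hq hT 2 0 (by omega)
  -- `A₁ = 2A₀ + PA₀`, `PA₁ = 2PA₀ + PPA₀`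
  have pA₁ : cellL2 L A₁ ≤ 2 * (neumannData L q G + C₀ * neumannData L q G) + (neumannData L q G + C₀ * neumannData L q G) := by
    rw [hA₁]
    have hc1' : ContinuousOn (fun x => (2 : ℝ) • A₀ x) 𝕂 := hA₀s.continuousOn.const_smul (2 : ℝ)
    refine (cellL2_add_le L hc1' (hP hA₀s).continuousOn).trans (add_le_add ?_ pPA₀)
    refine (cellL2_smul_le 2 _).trans ?_
    rw [abs_of_pos (by norm_num : (0 : ℝ) < 2)]
    exact mul_le_mul_of_nonneg_left pA₀ (by norm_num)
  have pPA₁ : cellL2 L (cylDeriv Pf A₁) ≤ 2 * (neumannData L q G + C₀ * neumannData L q G) +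
      (6 * neumannData L q G + (1 + 2 * C₀) * neumannData L q G) := by
    have hs2 : ContDiffOn ℝ ∞ (fun x => (2 : ℝ) • A₀ x) 𝕂 := (contDiffOn_const (c := (2 : ℝ))).smul hA₀s
    have e1 : EqOn (cylDeriv Pf A₁) (fun x => (2 : ℝ) • cylDeriv Pf A₀ x + cylDeriv Pf (cylDeriv Pf A₀) x) 𝕂 := by
      intro x hx
      rw [hA₁, cylDeriv_add (f := fun x => (2 : ℝ) • A₀ x) (g := cylDeriv Pf A₀) hs2 (hP hA₀s) hx,
        cylDeriv_const_smul (2 : ℝ) hA₀s hx]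
    rw [cellL2_congr_K e1]
    have hc2' : ContinuousOn (fun x => (2 : ℝ) • cylDeriv Pf A₀ x) 𝕂 := (hP hA₀s).continuousOn.const_smul (2 : ℝ)
    refine (cellL2_add_le L hc2' (hP (hP hA₀s)).continuousOn).trans (add_le_add ?_ pPPA₀)
    refine (cellL2_smul_le 2 _).trans ?_
    rw [abs_of_pos (by norm_num : (0 : ℝ) < 2)]
    exact mul_le_mul_of_nonneg_left pPA₀ (by norm_num)
  -- assemble
  have hc1 : ContinuousOn (fun x : ℝ³ => (2 * (x 0 ^ 2 + x 1 ^ 2)) • A₁ x) 𝕂 :=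
    ((continuous_const.mul (((contDiff_cylCoordFun 0).pow 2).add ((contDiff_cylCoordFun 1).pow 2)).continuous).continuousOn).smul
      hA₁s.continuousOn
  have hc2 : ContinuousOn (fun x : ℝ³ => (x 0 ^ 2 + x 1 ^ 2) • cylDeriv Pf A₁ x) 𝕂 :=
    ((((contDiff_cylCoordFun 0).pow 2).add ((contDiff_cylCoordFun 1).pow 2)).continuous.continuousOn).smul
      (hP hA₁s).continuousOn
  have hc3 : ContinuousOn (cylDeriv Pf B₁) 𝕂 := (hP hB₁s).continuousOn
  have q1 : cellL2 L (fun x : ℝ³ => (2 * (x 0 ^ 2 + x 1 ^ 2)) • A₁ x) ≤ 2 * cellL2 L A₁ := by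
    have e : (fun x : ℝ³ => (2 * (x 0 ^ 2 + x 1 ^ 2)) • A₁ x) = fun x => (2 : ℝ) • ((x 0 ^ 2 + x 1 ^ 2) • A₁ x) := by
      funext x; rw [smul_smul]
    rw [e]
    refine (cellL2_smul_le 2 _).trans ?_
    rw [abs_of_pos (by norm_num : (0 : ℝ) < 2)]
    exact mul_le_mul_of_nonneg_left (cellL2_sqRadius_smul_le L hA₁s.continuousOn) (by norm_num)
  have q2 : cellL2 L (fun x : ℝ³ => (x 0 ^ 2 + x 1 ^ 2) • cylDeriv Pf A₁ x) ≤ cellL2 L (cylDeriv Pf A₁) :=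
    cellL2_sqRadius_smul_le L (hP hA₁s).continuousOn
  calc _ ≤ cellL2 L (fun x : ℝ³ => (2 * (x 0 ^ 2 + x 1 ^ 2)) • A₁ x + (x 0 ^ 2 + x 1 ^ 2) • cylDeriv Pf A₁ x) +
        cellL2 L (cylDeriv Pf B₁) := cellL2_sub_le (hc1.add hc2) hc3
    _ ≤ (cellL2 L (fun x : ℝ³ => (2 * (x 0 ^ 2 + x 1 ^ 2)) • A₁ x) +
        cellL2 L (fun x : ℝ³ => (x 0 ^ 2 + x 1 ^ 2) • cylDeriv Pf A₁ x)) + cellL2 L (cylDeriv Pf B₁) :=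
        add_le_add (cellL2_add_le L hc1 hc2) le_rfl
    _ ≤ (2 * (2 * (neumannData L q G + C₀ * neumannData L q G) + (neumannData L q G + C₀ * neumannData L q G)) +
        (2 * (neumannData L q G + C₀ * neumannData L q G) + (6 * neumannData L q G + (1 + 2 * C₀) * neumannData L q G))) +
        (1 + 2 * C₀) * neumannData L q G :=
        add_le_add (add_le_add (q1.trans (mul_le_mul_of_nonneg_left pA₁ (by norm_num))) (q2.trans pPA₁)) pPPB₀
    _ = (16 + 12 * C₀) * neumannData L q G := by ring

end Main

/-! ### The main result -/

/-- **All frame words of `q` of length `1 ≤ a + j + e ≤ 4` by the data of the Neumann problem.** For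
`L > 0` there is `C` such that for all `q`, `G` smooth on the closed cylinder and `L`-periodic with
`∂_{x_h} q = G` on the wall, `‖P^a J^j E^e q‖_{L²(cell)} ≤ C 𝒟(q, G)` — the `H⁴(cell)`-control of `q`
in the frame, the normal derivatives recovered from the equation. [folklore] (given the cited
tangential and base Neumann estimates of the tree) -/
theorem exists_cellL2_pje_le_data {L : ℝ} (hL : 0 < L) :
    ∃ C : ℝ, 0 ≤ C ∧ ∀ (q G : ℝ³ → ℝ), ContDiffOn ℝ ∞ q 𝕂 → ContDiffOn ℝ ∞ G 𝕂 →
      IsAxiallyPeriodic L q → IsAxiallyPeriodic L G →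
      (∀ x ∈ frontier (unitCylinder : Set ℝ³), cylDeriv Pf q x = G x) →
      ∀ (a j e : ℕ), 1 ≤ a + j + e → a + j + e ≤ 4 →
        cellL2 L (cylWord (List.replicate a Pf ++ List.replicate j rotGen ++ List.replicate e Ef) q) ≤
          C * neumannData L q G := by
  obtain ⟨C₁, hC₁0, hC₁⟩ := exists_cellL2_cylGrad_le_of_neumann hL
  set C₀ : ℝ := 3 * C₁ + 5 with hC₀
  have hC₀0 : 0 ≤ C₀ := by positivity
  refine ⟨16 + 12 * C₀, by positivity, fun q G hq hG hqp hGp hN a j e h1 h4 => ?_⟩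
  have hT : ∀ β : List Bool, β.length ≤ 3 → cellL2 L (cylGrad (cylWord (tanWord β) q)) ≤ C₀ * neumannData L q G :=
    fun β hβ => cellL2_cylGrad_tanWord_le_data hL hq hG hqp hGp hN hC₁0 hC₁ β hβ
  have hD0 : 0 ≤ neumannData L q G := neumannData_nonneg
  have ha : a ≤ 4 := by omega
  interval_cases a
  · exact (cellL2_pje_zero_le hq hT j e (by omega) (by omega)).trans (by nlinarith)
  · exact (cellL2_pje_one_le hq hT j e (by omega)).trans (by nlinarith)
  · exact (cellL2_pje_two_le hq hT j e (by omega)).trans (by nlinarith)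
  · exact (cellL2_pje_three_le hq hT j e (by omega)).trans (by nlinarith)
  · obtain ⟨rfl, rfl⟩ : j = 0 ∧ e = 0 := ⟨by omega, by omega⟩
    exact cellL2_pje_four_le hq hT




end Literature.Analysis.FluidPDE
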